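import Literature.NumberTheory.Automorphic.IwahoriGL
import Literature.NumberTheory.Automorphic.GaussCellGL
import Literature.NumberTheory.Automorphic.IwasawaDecompositionGL
import HarnessLib

/-!
# The Iwahori factorisation of the first congruence subgroup of `GL_n(F)`

Topic `NumberTheory/Automorphic`; theorems only (no definition, no named fact). Setting: a field
`F` with a `ValuativeRel` (valuation ring `𝒪 = 𝒪[F]`, maximal ideal `𝓂`, residue field `𝓀`),
`K = GL_n(𝒪) = glInt n F` and the **first congruence subgroup**
`K₁ = 1 + 𝓂 M_n(𝒪) = ker (GL_n(𝒪) → GL_n(𝓀))`, which in the tree is the pro-unipotent radical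
`proUnipotentGL n F c` of `IwahoriGL` for a *constant* block labelling `c` (here
`c = (0 : Fin n → Fin 1)`); `B = standardParabolicGL F id` is the upper triangular Borel
subgroup and `B⁻ = standardParabolicGL F (toDual ∘ id)` the lower triangular one (`ParabolicGL`).

* `mem_congruenceOne_iff`, `mem_congruenceOne_of_forall_valuation_sub_lt_one`: `g ∈ K₁` iff
  `g ∈ GL_n(𝒪)` and `g ≡ 1 (mod 𝓂)` entrywise; the integrality of `g⁻¹` is automatic
  (`valuation_det_eq_one_of_forall_valuation_sub_lt_one`: `det g ≡ det 1 = 1 (mod 𝓂)`).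
* `exists_lower_mul_upper_of_mem_congruenceOne`, `exists_upper_mul_lower_of_mem_congruenceOne`
  (**Iwahori factorisation of `K₁`**): every `g ∈ K₁` is `g = l u = u' l'` with `l, l' ∈ K₁ ∩ B⁻`
  and `u, u' ∈ K₁ ∩ B`. Proof: the Gauss candidate `S(g) ∈ M_n(𝒪)` of `GaussCellGL` (`gaussS`,
  Cramer's rule in the leading blocks) commutes with reduction mod `𝓂` (`gaussS_map`), and
  `S(1) = 1` (`gaussS_one`), so `S(g) ≡ 1 (mod 𝓂)` lies in `K₁ ∩ B` while `g S(g)` is lower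
  triangular (`mul_gaussS_blockTriangular`); hence `g = (g S(g)) S(g)⁻¹`. This is the case
  `P = B` of the Iwahori factorisation of congruence subgroups (Casselman (1995), Prop. 1.4.4;
  Iwahori–Matsumoto (1965), §2) — only the set-theoretic factorisation in two orders is recorded,
  which is what the multiplicativity of the `K₁`-double-coset operators of dominant torus
  elements consumes (`CongruenceHeckeMultiplicative`).
* `coe_zpowDiagGL_conj_apply` and the **contraction properties of dominant torus elements**
  `t = ϖ^m = zpowDiagGL _ m`, `m` antitone (`m_1 ≥ ⋯ ≥ m_n`):
  `conj_mem_congruenceOne_inf_upper` (`t (K₁ ∩ B) t⁻¹ ⊆ K₁ ∩ B`) and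
  `inv_conj_mem_congruenceOne_inf_lower` (`t⁻¹ (K₁ ∩ B⁻) t ⊆ K₁ ∩ B⁻`): the entry `(i, j)` of
  `t x t⁻¹` is `ϖ^{m_i - m_j} x_{i j}` (Casselman (1995), Prop. 1.4.3).

## References

* W. Casselman, *Introduction to the theory of admissible representations of `p`-adic reductive
  groups*, unpublished notes (draft 1 May 1995), Prop. 1.4.3, Prop. 1.4.4 [Casselman1995].
* N. Iwahori, H. Matsumoto, *On some Bruhat decomposition and the structure of the Hecke rings
  of p-adic Chevalley groups*, Publ. Math. IHÉS 25 (1965), §2 [IwahoriMatsumoto1965].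
-/

noncomputable section

open Matrix ValuativeRel OrderDual

namespace Literature.NumberTheory.Automorphic

variable {n : ℕ} {F : Type*} [Field F] [ValuativeRel F]

/-! ### Membership in `K₁ = 1 + 𝓂 M_n(𝒪)` -/

section Membership

/-- **Membership in the first congruence subgroup**: `g ∈ K₁ ↔ g ∈ GL_n(𝒪)` and
`g ≡ 1 (mod 𝓂)` entrywise. [folklore] -/
theorem mem_congruenceOne_iff (g : GL (Fin n) F) :
    g ∈ proUnipotentGL n F (0 : Fin n → Fin 1) ↔ g ∈ glInt n F ∧
      ∀ i j, valuation F ((g : Matrix (Fin n) (Fin n) F) i j -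
        (1 : Matrix (Fin n) (Fin n) F) i j) < 1 := by
  rw [mem_proUnipotentGL_iff]
  constructor
  · rintro ⟨hg, -, h⟩
    refine ⟨hg, fun i j => ?_⟩
    rw [Matrix.one_apply]
    exact h i j rfl
  · rintro ⟨hg, h⟩
    refine ⟨hg, fun i j hij => (lt_irrefl _ hij).elim, fun i j _ => ?_⟩
    rw [← Matrix.one_apply]
    exact h i j

/-- A matrix `≡ 1 (mod 𝓂)` is integral. [folklore] -/
theorem isIntegralMatrix_of_forall_valuation_sub_lt_one {M : Matrix (Fin n) (Fin n) F}
    (h : ∀ i j, valuation F (M i j - (1 : Matrix (Fin n) (Fin n) F) i j) < 1) :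
    IsIntegralMatrix M := by
  intro i j
  have e : M i j = (M i j - (1 : Matrix (Fin n) (Fin n) F) i j) +
      (1 : Matrix (Fin n) (Fin n) F) i j := by ring
  rw [e]
  exact Subring.add_mem _ ((Valuation.mem_integer_iff _ _).mpr (h i j).le)
    (IsIntegralMatrix.one i j)

/-- The reduction mod `𝓂` of an integral model of a matrix `≡ 1 (mod 𝓂)` is the identity.
[folklore] -/
theorem map_residue_eq_one_of_forall_valuation_sub_lt_one {M₀ : Matrix (Fin n) (Fin n) 𝒪[F]}
    (h : ∀ i j, valuation F ((M₀ i j : F) - (1 : Matrix (Fin n) (Fin n) F) i j) < 1) :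
    M₀.map (IsLocalRing.residue 𝒪[F]) = 1 := by
  ext i j
  rw [Matrix.map_apply, ← sub_eq_zero, ← Matrix.map_one (IsLocalRing.residue 𝒪[F])
    (map_zero _) (map_one _), Matrix.map_apply, ← map_sub]
  apply residue_eq_zero_of_valuation_lt_one
  have e : (((M₀ i j - (1 : Matrix (Fin n) (Fin n) 𝒪[F]) i j : 𝒪[F]) : F)) =
      (M₀ i j : F) - (1 : Matrix (Fin n) (Fin n) F) i j := by
    rw [AddSubgroupClass.coe_sub, Matrix.one_apply, Matrix.one_apply]
    split_ifs <;> simp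
  rw [e]
  exact h i j

/-- A matrix `≡ 1 (mod 𝓂)` has determinant of valuation `1` (`det ≡ det 1 = 1 (mod 𝓂)`).
[folklore] -/
theorem valuation_det_eq_one_of_forall_valuation_sub_lt_one {M : Matrix (Fin n) (Fin n) F}
    (h : ∀ i j, valuation F (M i j - (1 : Matrix (Fin n) (Fin n) F) i j) < 1) :
    valuation F M.det = 1 := by
  obtain ⟨M₀, rfl⟩ := (isIntegralMatrix_of_forall_valuation_sub_lt_one h).exists_map
  have hres : M₀.map (IsLocalRing.residue 𝒪[F]) = 1 :=
    map_residue_eq_one_of_forall_valuation_sub_lt_one (fun i j => by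
      simpa [Matrix.map_apply] using h i j)
  have hdet : IsLocalRing.residue 𝒪[F] M₀.det = 1 := by
    rw [RingHom.map_det, RingHom.mapMatrix_apply, hres, det_one]
  have hunit : IsUnit M₀.det := by
    by_contra hnu
    have hmem : M₀.det ∈ IsLocalRing.maximalIdeal 𝒪[F] :=
      (IsLocalRing.mem_maximalIdeal _).mpr (mem_nonunits_iff.mpr hnu)
    rw [← IsLocalRing.residue_eq_zero_iff, hdet] at hmem
    exact one_ne_zero hmem
  rw [← RingHom.mapMatrix_apply, ← RingHom.map_det]
  exact (Valuation.Integers.isUnit_iff_valuation_eq_one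
    (Valuation.integer.integers (valuation F))).mp hunit

/-- **Sufficient criterion for `K₁`**: an invertible matrix `≡ 1 (mod 𝓂)` entrywise lies in
`K₁` (its inverse is automatically integral). [folklore] -/
theorem mem_congruenceOne_of_forall_valuation_sub_lt_one (g : GL (Fin n) F)
    (h : ∀ i j, valuation F ((g : Matrix (Fin n) (Fin n) F) i j -
      (1 : Matrix (Fin n) (Fin n) F) i j) < 1) :
    g ∈ proUnipotentGL n F (0 : Fin n → Fin 1) :=
  (mem_congruenceOne_iff g).mpr ⟨mem_glInt_of_isIntegralMatrix
    (isIntegralMatrix_of_forall_valuation_sub_lt_one h)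
    (valuation_det_eq_one_of_forall_valuation_sub_lt_one h), h⟩

/-- `K₁ ≤ GL_n(𝒪)`. [folklore] -/
theorem congruenceOne_le_glInt : proUnipotentGL n F (0 : Fin n → Fin 1) ≤ glInt n F :=
  proUnipotentGL_le_glInt n F _

end Membership

/-! ### The Gauss candidate of the identity and the Iwahori factorisation of `K₁` -/

section Factorisation

/-- The Gauss candidate of the identity matrix is the identity: `S(1) = 1` (all leading minors
are `1` and the Cramer solutions of `1 · v = -e_j` restricted above the diagonal vanish).
[folklore] -/
theorem gaussS_one {R : Type*} [CommRing R] {m : Type*} [Fintype m] [DecidableEq m]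
    {α : Type*} [LinearOrder α] (b : m → α) : gaussS b (1 : Matrix m m R) = 1 := by
  ext i j
  by_cases hij : b i < b j
  · have hne : i ≠ j := fun h => by rw [h] at hij; exact lt_irrefl _ hij
    rw [gaussS_apply_of_lt _ hij]
    simp only [leadBlock, Matrix.toBlock_one_self, Matrix.cramer_one, Module.End.one_apply,
      Matrix.one_apply_ne hne, neg_zero]
  · simp only [gaussS, Matrix.of_apply, dif_neg hij, leadMinor_one, Matrix.one_apply]

/-- **Iwahori factorisation of `K₁`, lower–upper order**: every `g ∈ K₁ = 1 + 𝓂 M_n(𝒪)`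
factors as `g = l u` with `l ∈ K₁` lower triangular and `u ∈ K₁` upper triangular
(Casselman (1995), Prop. 1.4.4 for `P = B`; via the Gauss candidate `S(g)` of `GaussCellGL`,
which is `≡ S(1) = 1 (mod 𝓂)`). [cite: Casselman1995, Prop. 1.4.4] -/
theorem exists_lower_mul_upper_of_mem_congruenceOne {g : GL (Fin n) F}
    (hg : g ∈ proUnipotentGL n F (0 : Fin n → Fin 1)) :
    ∃ l u : GL (Fin n) F, l ∈ proUnipotentGL n F (0 : Fin n → Fin 1) ∧
      l ∈ standardParabolicGL F (toDual ∘ (id : Fin n → Fin n)) ∧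
      u ∈ proUnipotentGL n F (0 : Fin n → Fin 1) ∧
      u ∈ standardParabolicGL F (id : Fin n → Fin n) ∧ g = l * u := by
  have hg1 := ((mem_congruenceOne_iff g).mp hg).2
  obtain ⟨M₀, hM₀⟩ := (isIntegralMatrix_of_mem_glInt (congruenceOne_le_glInt hg)).exists_map
  -- the Gauss candidate over `𝒪` and its reduction
  set S₀ : Matrix (Fin n) (Fin n) 𝒪[F] := gaussS (id : Fin n → Fin n) M₀ with hS₀
  have hres : M₀.map (IsLocalRing.residue 𝒪[F]) = 1 :=
    map_residue_eq_one_of_forall_valuation_sub_lt_one (fun i j => by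
      have := hg1 i j
      rwa [← hM₀, Matrix.map_apply] at this)
  have hSres : S₀.map (IsLocalRing.residue 𝒪[F]) = 1 := by
    rw [hS₀, ← gaussS_map, hres, gaussS_one]
  -- the candidate viewed in `M_n(F)` is `≡ 1 (mod 𝓂)`
  set S : Matrix (Fin n) (Fin n) F := S₀.map (𝒪[F]).subtype with hS
  have hS1 : ∀ i j, valuation F (S i j - (1 : Matrix (Fin n) (Fin n) F) i j) < 1 := by
    intro i j
    have hij := congr_fun (congr_fun hSres i) j
    rw [Matrix.map_apply, ← Matrix.map_one (IsLocalRing.residue 𝒪[F]) (map_zero _) (map_one _),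
      Matrix.map_apply, ← sub_eq_zero, ← map_sub] at hij
    have hv := valuation_lt_one_of_residue_eq_zero hij
    have e : (((S₀ i j - (1 : Matrix (Fin n) (Fin n) 𝒪[F]) i j : 𝒪[F]) : F)) =
        S i j - (1 : Matrix (Fin n) (Fin n) F) i j := by
      rw [hS, AddSubgroupClass.coe_sub, Matrix.map_apply, Matrix.one_apply, Matrix.one_apply]
      split_ifs <;> simp
    rwa [e] at hv
  have hSdet : S.det ≠ 0 := by
    intro h0
    have := valuation_det_eq_one_of_forall_valuation_sub_lt_one hS1
    rw [h0, map_zero] at this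
    exact zero_ne_one this
  set u : GL (Fin n) F := Matrix.GeneralLinearGroup.mkOfDetNeZero S hSdet with hu
  have hucoe : (u : Matrix (Fin n) (Fin n) F) = S := rfl
  have huK : u ∈ proUnipotentGL n F (0 : Fin n → Fin 1) :=
    mem_congruenceOne_of_forall_valuation_sub_lt_one u (hucoe ▸ hS1)
  have huB : u ∈ standardParabolicGL F (id : Fin n → Fin n) := by
    rw [mem_standardParabolicGL_iff, hucoe]
    intro i j hij
    rw [hS, Matrix.map_apply, show S₀ i j = 0 from gaussS_blockTriangular M₀ hij, map_zero]
  -- `g S` is lower triangular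
  have hgS : ((g * u : GL (Fin n) F) : Matrix (Fin n) (Fin n) F).BlockTriangular
      (toDual ∘ (id : Fin n → Fin n)) := by
    rw [Units.val_mul, hucoe, ← hM₀, hS]
    change ((𝒪[F]).subtype.mapMatrix M₀ * (𝒪[F]).subtype.mapMatrix S₀).BlockTriangular _
    rw [← map_mul]
    intro i j hij
    rw [RingHom.mapMatrix_apply, Matrix.map_apply,
      show (M₀ * S₀) i j = 0 from mul_gaussS_blockTriangular M₀ hij, map_zero]
  refine ⟨g * u, u⁻¹, Subgroup.mul_mem _ hg huK, hgS, Subgroup.inv_mem _ huK,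
    Subgroup.inv_mem _ huB, ?_⟩
  rw [mul_inv_cancel_right]

/-- **Iwahori factorisation of `K₁`, upper–lower order**: every `g ∈ K₁` factors as `g = u l`
with `u ∈ K₁` upper triangular and `l ∈ K₁` lower triangular (apply the lower–upper
factorisation to `g⁻¹`). [cite: Casselman1995, Prop. 1.4.4] -/
theorem exists_upper_mul_lower_of_mem_congruenceOne {g : GL (Fin n) F}
    (hg : g ∈ proUnipotentGL n F (0 : Fin n → Fin 1)) :
    ∃ u l : GL (Fin n) F, u ∈ proUnipotentGL n F (0 : Fin n → Fin 1) ∧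
      u ∈ standardParabolicGL F (id : Fin n → Fin n) ∧
      l ∈ proUnipotentGL n F (0 : Fin n → Fin 1) ∧
      l ∈ standardParabolicGL F (toDual ∘ (id : Fin n → Fin n)) ∧ g = u * l := by
  obtain ⟨l, u, hlK, hlB, huK, huB, h⟩ :=
    exists_lower_mul_upper_of_mem_congruenceOne (Subgroup.inv_mem _ hg)
  refine ⟨u⁻¹, l⁻¹, Subgroup.inv_mem _ huK, Subgroup.inv_mem _ huB, Subgroup.inv_mem _ hlK,
    Subgroup.inv_mem _ hlB, ?_⟩
  rw [← inv_inv g, h, _root_.mul_inv_rev]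

end Factorisation

/-! ### Dominant torus elements contract `K₁ ∩ B` and expand `K₁ ∩ B⁻` -/

section Torus

variable {ϖ : F}

omit [ValuativeRel F] in
/-- The entries of `ϖ^m x ϖ^{-m}`: `(ϖ^m x ϖ^{-m})_{ij} = ϖ^{m_i - m_j} x_{ij}`. [folklore] -/
theorem coe_zpowDiagGL_conj_apply (hϖ : ϖ ≠ 0) (m : Fin n → ℤ) (x : GL (Fin n) F) (i j : Fin n) :
    ((zpowDiagGL hϖ m * x * zpowDiagGL hϖ (-m) : GL (Fin n) F) : Matrix (Fin n) (Fin n) F) i j =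
      ϖ ^ (m i - m j) * (x : Matrix (Fin n) (Fin n) F) i j := by
  rw [Units.val_mul, Units.val_mul, coe_zpowDiagGL, coe_zpowDiagGL,
    diagonal_mul_mul_diagonal_apply, Pi.neg_apply, _root_.zpow_neg, zpow_sub₀ hϖ,
    div_eq_mul_inv]
  ring

/-- A matrix `≡ 1 (mod 𝓂)` stays `≡ 1 (mod 𝓂)` when its entries are multiplied by
non-negative powers of a uniformizing element off the diagonal (and by `ϖ^0` on it).
[folklore] -/
theorem valuation_zpow_mul_sub_lt_one (hϖ : IsUniformizingElement ϖ)
    {x : Matrix (Fin n) (Fin n) F}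
    (hx : ∀ i j, valuation F (x i j - (1 : Matrix (Fin n) (Fin n) F) i j) < 1)
    {e : Fin n → Fin n → ℤ} (he0 : ∀ i, e i i = 0) (he : ∀ i j, x i j ≠ 0 → 0 ≤ e i j)
    (i j : Fin n) :
    valuation F (ϖ ^ e i j * x i j - (1 : Matrix (Fin n) (Fin n) F) i j) < 1 := by
  by_cases hij : i = j
  · subst hij
    rw [he0, zpow_zero, one_mul]
    exact hx i i
  · rw [Matrix.one_apply_ne hij, sub_zero]
    by_cases hx0 : x i j = 0
    · rw [hx0, mul_zero, map_zero]; exact zero_lt_one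
    · have h2 : valuation F (x i j) < 1 := by
        simpa [Matrix.one_apply_ne hij] using hx i j
      have h1 : valuation F (ϖ ^ e i j) ≤ 1 := by
        obtain ⟨k, hk⟩ := Int.eq_ofNat_of_zero_le (he i j hx0)
        rw [hk, zpow_natCast, map_pow]
        exact pow_le_one₀ zero_le hϖ.valuation_le_one
      rw [map_mul, mul_comm]
      exact mul_lt_one_of_lt_of_le h2 h1

/-- **Dominant torus elements contract `K₁ ∩ B`**: for `m` antitone (`m_1 ≥ ⋯ ≥ m_n`) and
`x ∈ K₁` upper triangular, `ϖ^m x ϖ^{-m} ∈ K₁` is upper triangular (entries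
`ϖ^{m_i - m_j} x_{ij}`, `m_i - m_j ≥ 0` for `i ≤ j`; Casselman (1995), Prop. 1.4.3).
[cite: Casselman1995, Prop. 1.4.3] -/
theorem conj_mem_congruenceOne_inf_upper (hϖ : IsUniformizingElement ϖ) {m : Fin n → ℤ}
    (hm : Antitone m) {x : GL (Fin n) F} (hxK : x ∈ proUnipotentGL n F (0 : Fin n → Fin 1))
    (hxB : x ∈ standardParabolicGL F (id : Fin n → Fin n)) :
    zpowDiagGL hϖ.ne_zero m * x * zpowDiagGL hϖ.ne_zero (-m) ∈
        proUnipotentGL n F (0 : Fin n → Fin 1) ∧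
      zpowDiagGL hϖ.ne_zero m * x * zpowDiagGL hϖ.ne_zero (-m) ∈
        standardParabolicGL F (id : Fin n → Fin n) := by
  have hB : zpowDiagGL hϖ.ne_zero m * x * zpowDiagGL hϖ.ne_zero (-m) ∈
      standardParabolicGL F (id : Fin n → Fin n) :=
    Subgroup.mul_mem _ (Subgroup.mul_mem _ (blockTriangular_zpowDiagGL hϖ.ne_zero m) hxB)
      (blockTriangular_zpowDiagGL hϖ.ne_zero (-m))
  refine ⟨mem_congruenceOne_of_forall_valuation_sub_lt_one _ fun i j => ?_, hB⟩
  rw [coe_zpowDiagGL_conj_apply]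
  refine valuation_zpow_mul_sub_lt_one hϖ ((mem_congruenceOne_iff x).mp hxK).2
    (e := fun i j => m i - m j) (fun i => sub_self _) (fun i j hij => ?_) i j
  -- `x i j ≠ 0` forces `i ≤ j` (upper triangular), so `m j ≤ m i`
  have hle : i ≤ j := by
    by_contra hlt
    exact hij ((mem_standardParabolicGL_iff _ x).mp hxB (not_le.mp hlt))
  exact sub_nonneg.mpr (hm hle)

/-- **Dominant torus elements expand `K₁ ∩ B⁻`**: for `m` antitone and `l ∈ K₁` lower
triangular, `ϖ^{-m} l ϖ^{m} ∈ K₁` is lower triangular (entries `ϖ^{m_j - m_i} l_{ij}`,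
`m_j - m_i ≥ 0` for `i ≥ j`; Casselman (1995), Prop. 1.4.3). [cite: Casselman1995, Prop. 1.4.3] -/
theorem inv_conj_mem_congruenceOne_inf_lower (hϖ : IsUniformizingElement ϖ) {m : Fin n → ℤ}
    (hm : Antitone m) {l : GL (Fin n) F} (hlK : l ∈ proUnipotentGL n F (0 : Fin n → Fin 1))
    (hlB : l ∈ standardParabolicGL F (toDual ∘ (id : Fin n → Fin n))) :
    zpowDiagGL hϖ.ne_zero (-m) * l * zpowDiagGL hϖ.ne_zero m ∈
        proUnipotentGL n F (0 : Fin n → Fin 1) ∧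
      zpowDiagGL hϖ.ne_zero (-m) * l * zpowDiagGL hϖ.ne_zero m ∈
        standardParabolicGL F (toDual ∘ (id : Fin n → Fin n)) := by
  have hdiag : ∀ m' : Fin n → ℤ, zpowDiagGL hϖ.ne_zero m' ∈
      standardParabolicGL F (toDual ∘ (id : Fin n → Fin n)) := fun m' => by
    rw [mem_standardParabolicGL_iff, coe_zpowDiagGL]
    exact Matrix.blockTriangular_diagonal _
  have hB : zpowDiagGL hϖ.ne_zero (-m) * l * zpowDiagGL hϖ.ne_zero m ∈
      standardParabolicGL F (toDual ∘ (id : Fin n → Fin n)) :=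
    Subgroup.mul_mem _ (Subgroup.mul_mem _ (hdiag (-m)) hlB) (hdiag m)
  refine ⟨mem_congruenceOne_of_forall_valuation_sub_lt_one _ fun i j => ?_, hB⟩
  have e : zpowDiagGL hϖ.ne_zero (-m) * l * zpowDiagGL hϖ.ne_zero m =
      zpowDiagGL hϖ.ne_zero (-m) * l * zpowDiagGL hϖ.ne_zero (-(-m)) := by rw [neg_neg]
  rw [e, coe_zpowDiagGL_conj_apply]
  refine valuation_zpow_mul_sub_lt_one hϖ ((mem_congruenceOne_iff l).mp hlK).2
    (e := fun i j => (-m) i - (-m) j) (fun i => sub_self _) (fun i j hij => ?_) i j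
  -- `l i j ≠ 0` forces `j ≤ i` (lower triangular), so `m i ≤ m j`
  have hle : j ≤ i := by
    by_contra hlt
    exact hij ((mem_standardParabolicGL_iff _ l).mp hlB
      (show (toDual ∘ id) j < (toDual ∘ id) i from toDual_lt_toDual.mpr (not_le.mp hlt)))
  simp only [Pi.neg_apply, sub_neg_eq_add, neg_add_eq_sub]
  exact sub_nonneg.mpr (hm hle)

/-- **Borel representatives of the `K₁`-cosets in `K₁ ϖ^m K₁`** (`m` antitone): for `k ∈ K₁`
there is `b ∈ K₁ ∩ B` with `k ϖ^m K₁ = b ϖ^m K₁` — write `k = b l` (Iwahori factorisation) and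
move `l` across: `l ϖ^m = ϖ^m (ϖ^{-m} l ϖ^m)` with `ϖ^{-m} l ϖ^m ∈ K₁`. [folklore] -/
theorem exists_upper_mul_zpowDiagGL_coset_eq (hϖ : IsUniformizingElement ϖ) {m : Fin n → ℤ}
    (hm : Antitone m) {k : GL (Fin n) F} (hk : k ∈ proUnipotentGL n F (0 : Fin n → Fin 1)) :
    ∃ b : GL (Fin n) F, b ∈ proUnipotentGL n F (0 : Fin n → Fin 1) ∧
      b ∈ standardParabolicGL F (id : Fin n → Fin n) ∧
      (b * zpowDiagGL hϖ.ne_zero m)⁻¹ * (k * zpowDiagGL hϖ.ne_zero m) ∈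
        proUnipotentGL n F (0 : Fin n → Fin 1) := by
  obtain ⟨b, l, hbK, hbB, hlK, hlB, rfl⟩ := exists_upper_mul_lower_of_mem_congruenceOne hk
  refine ⟨b, hbK, hbB, ?_⟩
  have e : (b * zpowDiagGL hϖ.ne_zero m)⁻¹ * (b * l * zpowDiagGL hϖ.ne_zero m) =
      zpowDiagGL hϖ.ne_zero (-m) * l * zpowDiagGL hϖ.ne_zero m := by
    rw [zpowDiagGL_neg]; group
  rw [e]
  exact (inv_conj_mem_congruenceOne_inf_lower hϖ hm hlK hlB).1

end Torus

end Literature.NumberTheory.Automorphic
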